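import Summits.ResolutionOfSingularities.ResolutionOfSingularities.Theses.IndSmooth
import Summits.ResolutionOfSingularities.ResolutionOfSingularities.Theorems.IndSmoothValuativeSmoothingTemkinRegularChart
import Summits.ResolutionOfSingularities.ResolutionOfSingularities.Theorems.IndSmoothValuativeSmoothingSmoothNbhd
import Literature.AlgebraicGeometry.Resolution.RankOneReductionProofs
import HarnessLib

/-!
# The crux `IndSmooth.ValuativeSmoothing` at uniformizable valuation rings, and from RANK-ONE
# relative local uniformization (Novacoski–Spivakovsky 2014)

Support file for crux stmt-ResolutionOfSingularities-16087 (`ValuativeSmoothing`, route file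
`Theses/IndSmooth.lean`), lead seat c2 of line `birth` (reshape r6).

* `smoothFactor_of_relLocalUniformization` — **pointwise**: over a perfect field `k`, for a
  finitely generated `K/k` and a valuation ring `O ⊇ k` of `K` admitting RELATIVE LOCAL
  UNIFORMIZATION (`Literature.…RelLocalUniformization k K O`, Novacoski–Spivakovsky Def. 2.20:
  every affine model inside `O` is dominated by a finitely generated `A ⊆ O` regular at the
  centre), the conclusion of `ValuativeSmoothing` holds at `O`: every finitely generated `R ⊆ O`
  factors `R → T → O` through a smooth `k`-algebra. (Enlarge `R` to an affine model,
  `exists_affineModel_ge`; uniformize; regular at the centre over a perfect field ⇒ a smooth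
  basic open neighbourhood inside `O`, `stub_smoothNbhd` p153448.) So the open core of the
  crux lies, valuation ring by valuation ring, inside the failure set of local uniformization.
* `valuativeSmoothing_of_rankOne_relLocalUniformization` — **global**: by the PROVED reduction
  of local uniformization to rank one (`NovacoskiSpivakovsky2014_holds`), `ValuativeSmoothing`
  follows from relative local uniformization of the RANK-ONE valuation rings of function fields
  over perfect fields of positive characteristic alone.

## Sources

* J. Novacoski, M. Spivakovsky, *Reduction of local uniformization to the rank one case*,
  EMS Ser. Congr. Rep. (2014), Thm. 1.1, Def. 2.20. [NovacoskiSpivakovsky2014]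
* H. Matsumura, *Commutative Ring Theory* (1987), §30, Remark 2 after Thm. 30.3. [Matsumura1987]
-/

-- single-problem summit: the doubled namespace component is forced
set_option linter.dupNamespace false

namespace Summit.ResolutionOfSingularities.ResolutionOfSingularities.Theorems.ValuativeSmoothing

open IsLocalRing Literature.AlgebraicGeometry.Resolution
open Summit.ResolutionOfSingularities.ResolutionOfSingularities.Theses.IndSmooth (ValuativeSmoothing)

/-- **The crux `ValuativeSmoothing` at a valuation ring admitting relative local
uniformization** (pointwise; `k` perfect, any characteristic): if `O ⊇ k` is a valuation ring of
the finitely generated field `K/k` with `RelLocalUniformization k K O`, then every finitely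
generated `k`-subalgebra `R ⊆ O` factors `R → T → O ⊆ K` through a smooth `k`-algebra `T`:
enlarge `R` to an affine model `A₀ ⊆ O` (`exists_affineModel_ge`), dominate it by a finitely
generated `A ⊆ O` regular at the centre (the hypothesis), and take a smooth basic open
neighbourhood `A ≤ N' ⊆ O` of the centre (`stub_smoothNbhd`).
[cite: NovacoskiSpivakovsky2014, Def. 2.20] -/
theorem smoothFactor_of_relLocalUniformization (k K : Type) [Field k] [PerfectField k] [Field K]
    [Algebra k K] (hK : (⊤ : IntermediateField k K).FG) (O : ValuationSubring K)
    (hO : ∀ c : k, algebraMap k K c ∈ O) (hLU : RelLocalUniformization k K O)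
    (R : Subalgebra k K) (hR : R.FG) (hRO : R.toSubring ≤ O.toSubring) :
    ∃ (T : Type) (_ : CommRing T) (_ : Algebra k T), Algebra.Smooth k T ∧
      ∃ (ψ : R →ₐ[k] T) (χ : T →ₐ[k] K), (∀ t : T, χ t ∈ O) ∧ ∀ r : R, χ (ψ r) = (r : K) := by
  -- an affine model `A₀` of `O` above `R`
  obtain ⟨A₀, hRA₀, hA₀O, hA₀fg, hA₀fr⟩ := exists_affineModel_ge k K hK O hO R hR hRO
  -- uniformize it
  obtain ⟨A, hAO, hA₀A, hAfg, hreg⟩ := hLU A₀ hA₀fg hA₀fr hA₀O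
  -- a smooth basic open neighbourhood of the centre inside `O`
  obtain ⟨N', hN'O, -, hN's, hAN'⟩ := stub_smoothNbhd k K O A hAO hAfg hreg
  exact ⟨N', inferInstance, inferInstance, hN's, Subalgebra.inclusion (hRA₀.trans (hA₀A.trans hAN')),
    N'.val, fun t => hN'O t.2, fun _ => rfl⟩

/-- **`ValuativeSmoothing` from rank-one relative local uniformization.** If every RANK-ONE
valuation ring of every field `K ⊇ k`, for every perfect field `k` of positive characteristic
`p`, admits relative local uniformization over `k` (Novacoski–Spivakovsky Def. 2.20), then the
crux `IndSmooth.ValuativeSmoothing` holds: by the proved reduction of local uniformization to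
the rank-one case (`NovacoskiSpivakovsky2014_holds`, Thm. 1.1 of the paper) every valuation ring
then admits relative local uniformization, and `smoothFactor_of_relLocalUniformization`
concludes. [cite: NovacoskiSpivakovsky2014, Thm. 1.1] -/
theorem valuativeSmoothing_of_rankOne_relLocalUniformization
    (h : ∀ p : ℕ, p.Prime → ∀ (k : Type) [Field k] [CharP k p] [PerfectField k]
      (K : Type) [Field K] [Algebra k K] (O : ValuationSubring K),
      Nonempty O.valuation.RankOne → RelLocalUniformization k K O) :
    ValuativeSmoothing := by
  intro p hp k K _ _ _ _ _ hK O hO R hR hRO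
  have hLU : RelLocalUniformization k K O :=
    NovacoskiSpivakovsky2014_holds k (fun K _ _ O hO1 => h p hp k K O hO1) K O
  exact smoothFactor_of_relLocalUniformization k K hK O hO hLU R hR hRO

end Summit.ResolutionOfSingularities.ResolutionOfSingularities.Theorems.ValuativeSmoothing
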